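import Summits.QuantumFields.BalabanUV.Beta.EriceFlowEnclosureB12AsPrintedHistoryContagionShiftFlowZeroSemigroupVelocity

/-!
# Beta / EriceFlowEnclosureB12AsPrintedHistoryContagionShiftFlowZeroSemigroupGellMannLow — ASYMPTOTIC FREEDOM IS CONTAGIOUS, part 56: THE GELL-MANN–LOW EQUATION OF THE
# FLOW WITH MEMORY, WHEREVER IT MAKES SENSE — the velocity of the continuous renormalization group, where it exists, IS `β₀∕Λ′` at the running coupling, and it exists at
# almost every scale (part 55).  ABSTRACT (Λ strictly antitone on ]0, e′] onto `[Λ e′, ∞[` with part 35's chart bounds (2∕3, 4∕3)): (§88) if Λ has derivative D at the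
# interior running coupling `x = φ_s g` then **`∂_s φ_s g = β₀∕D`** (**`hasDerivAt_rg_of_hasDerivAt_abel`**); CONVERSELY if `s ↦ φ_s g` has a velocity V at s then `V ≠ 0`
# and Λ has derivative `β₀∕V` at `φ_s g` (**`hasDerivAt_abel_of_hasDerivAt_rg`**: `Λ⁻¹` expands chart distances by part 35's upper bound, so its derivative cannot vanish)
# — so **`s ↦ φ_s g` is differentiable at s IFF Λ is differentiable at `φ_s g`** (**`differentiableAt_rg_iff`**): the scales at which the continuous RG has a velocity are
# EXACTLY the visits of the orbit to the differentiability set of the Λ-coordinate, a set of full measure; the dependence on the pin **`∂_g φ_s g = Λ′(g)∕Λ′(φ_s g)`**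
# (**`hasDerivAt_rg_pin`** — the classical `∂g(s)∕∂g(0) = β(g(s))∕β(g(0))`), hence the LINEAR RENORMALIZATION-GROUP EQUATION **`∂_s φ = β_c(g)·∂_g φ`**, `β_c := β₀∕Λ′`
# (`rg_transport`); (§89) the velocity, where it exists, is NEGATIVE with **`−(3∕4)β₀x³ ≤ ∂_s φ_s g ≤ −(3∕8)β₀x³`** (**`velocity_bounds`**) and in the chart
# **`(3∕4)β₀ ≤ ∂_s(1∕φ_s(g)²) ≤ (3∕2)β₀`** (`hasDerivAt_rg_chart`) — the infinitesimal form of part 46's rates —, and AT ALMOST EVERY SCALE THE GELL-MANN–LOW EQUATION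
# HOLDS (**`ae_velocity`**).  Part 57 sharpens (2∕3, 4∕3) to `1 ± κx` for dynamical Abel functions of the flow: the velocity is `−(β₀∕2)x³(1 + O(x))`, ONE-LOOP UNIVERSAL.
# Abstract in Λ (β-flow team, prover 1 = recursion ∕ upper ∕ bare-coupling ∕ uniqueness side, unit `b2b-balaban-beta-bflow-p1`, gen 41; ROW AP-I·Uc × NODE U2 — the
# infinitesimal renormalization group, over part 55 `…SemigroupVelocity` and part 54 `…SemigroupBackward`)

HONEST FRAMING (page 1 of everything the β sub-cell writes): discharging `BetaPertH` makes Bałaban's UV stability UNCONDITIONAL — a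
real constructive-QFT result; it is NOT the continuum limit and NOT the Clay problem.  HONEST DEPENDENCY (cell reorg 2026-08-19,
verbatim): «continuum YM on T⁴ ⇐ BetaPertH ∧ nine spine estimates (0/9 proved); BetaPertH ⇐ (D1) ∧ (D4) ∧ CAP+tail; G-an2-4 gates
asym, D1 and NE2/3/4.»  THIS MODULE DISCHARGES NOTHING: [folklore] real analysis (chain rule, derivative of a left inverse, Lebesgue a.e.) about an ABSTRACT strictly
antitone function Λ with two-sided chart bounds — the shape part 35 `…ShiftFlowZeroLambda` PROVES for the relative Λ-parameter of the flow with memory near the zero pin;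
no hypothesis shape of node U2 is touched, nothing restated.  NOTHING is asserted about Bałaban's actual β; «Gell-Mann–Low equation», «β_c», «linear RG equation» are
OUR READING (Gell-Mann–Low 1954 ∕ Callan–Symanzik are the physics analogues; nothing of them is imported or claimed); precedent for differentiable iteration groups:
Szekeres 1958 ∕ Kuczma–Choczewski–Ger 1990.  [I] = T. Bałaban, Commun. Math. Phys. **109** (1987) 249–301 [Balaban1987RG1]: Thm 2 (0.31) p. 259, (0.18)–(0.20)
pp. 255–256, §5 p. 298 — context of the row only.

WHAT THIS FILE PROVES (0 sorry, 0 def): §88 **`hasDerivAt_rg_of_hasDerivAt_abel`**, **`hasDerivAt_abel_of_hasDerivAt_rg`**, **`differentiableAt_rg_iff`**,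
**`hasDerivAt_rg_pin`**, **`rg_transport`**; §89 **`velocity_bounds`**, **`hasDerivAt_rg_chart`**, **`ae_velocity`**.  NOT CLAIMED: a velocity at EVERY scale (needs Λ
differentiable everywhere: part 59's abstract smooth theory); anything about Bałaban's β; `BetaPertH`; continuum; Clay.
-/

namespace Summit.QuantumFields.BalabanUV.Beta.EriceFlowEnclosureB12AsPrintedHistoryContagionShiftFlowZeroSemigroupGellMannLow

open Filter Topology Set Function MeasureTheory
open Summit.QuantumFields.BalabanUV.Beta.EriceFlowEnclosureB12AsPrintedHistoryContagionShiftFlowZeroSemigroup (rg_mem_eq rg_lt_rg_of_lt)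
open Summit.QuantumFields.BalabanUV.Beta.EriceFlowEnclosureB12AsPrintedHistoryContagionShiftFlowZeroSemigroupBackward (rg_mem_eq_of_le)
open Summit.QuantumFields.BalabanUV.Beta.EriceFlowEnclosureB12AsPrintedHistoryContagionShiftFlowZeroSemigroupVelocity (abs_deriv_ge_of_expansive
  ae_differentiableAt_rg abel_continuousAt hasDerivAt_abel_bounds abelInv_continuousAt hasDerivAt_abelInv)

noncomputable section

variable {Λ : ℝ → ℝ} {e' β₀ : ℝ}

/-! ## §88 The Gell-Mann–Low equation where it makes sense; the pin derivative; the linear RG equation -/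

/-- **THE GELL-MANN–LOW EQUATION OF THE FLOW WITH MEMORY, WHERE IT MAKES SENSE.**  Λ strictly antitone on ]0, e′] onto `[Λ e′, ∞[` with the chart bounds (2∕3, 4∕3); a
coupling `g` and a real time s with `Λ e′ < Λ g + sβ₀` (the running coupling `x = φ_s g` is interior); Λ has derivative D at x.  THEN the running coupling has a VELOCITY
at the scale s: **`∂_s φ_s g = β₀∕D = β₀∕Λ′(φ_s g)`** — the infinitesimal generator is the function `β_c = β₀∕Λ′` evaluated AT THE RUNNING COUPLING, wherever Λ′ exists.
[folklore; Szekeres 1958 for regular iteration groups] -/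
theorem hasDerivAt_rg_of_hasDerivAt_abel (hanti : StrictAntiOn Λ (Ioc 0 e')) (honto : ∀ y : ℝ, Λ e' ≤ y → ∃ x ∈ Ioc (0 : ℝ) e', Λ x = y) (hβ₀ : 0 < β₀)
    (hbounds : ∀ e₁ ∈ Ioc (0 : ℝ) e', ∀ e₂ ∈ Ioc (0 : ℝ) e', e₁ ≤ e₂ →
      2 / 3 * (1 / e₁ ^ 2 - 1 / e₂ ^ 2) ≤ Λ e₁ - Λ e₂ ∧ Λ e₁ - Λ e₂ ≤ 4 / 3 * (1 / e₁ ^ 2 - 1 / e₂ ^ 2))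
    {g s D : ℝ} (hgs : Λ e' < Λ g + s * β₀) (hD : HasDerivAt Λ D (invFunOn Λ (Ioc 0 e') (Λ g + s * β₀))) :
    HasDerivAt (fun σ : ℝ => invFunOn Λ (Ioc 0 e') (Λ g + σ * β₀)) (β₀ / D) s := by
  obtain ⟨hxmem, hΛx⟩ := rg_mem_eq_of_le honto hgs.le
  set x := invFunOn Λ (Ioc 0 e') (Λ g + s * β₀) with hxdef
  have he' : e' ∈ Ioc (0 : ℝ) e' := ⟨hxmem.1.trans_le hxmem.2, le_rfl⟩
  have hxlt : x < e' := by
    rcases hxmem.2.lt_or_eq with h | h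
    · exact h
    · exfalso; rw [h] at hΛx; linarith
  have hx : x ∈ Ioo (0 : ℝ) e' := ⟨hxmem.1, hxlt⟩
  have hinv := hasDerivAt_abelInv hanti honto hβ₀ hbounds hx hD
  rw [hΛx] at hinv
  have hinner : HasDerivAt (fun σ : ℝ => Λ g + σ * β₀) β₀ s := by
    have := (hasDerivAt_mul_const β₀ (x := s)).const_add (Λ g)
    simpa using this
  have hcomp := hinv.comp s hinner
  refine (hcomp.congr_of_eventuallyEq (Eventually.of_forall fun σ => rfl)).congr_deriv ?_
  rw [div_eq_inv_mul]

/-- **THE CONVERSE: A VELOCITY OF THE RUNNING COUPLING FORCES A DERIVATIVE OF Λ.**  In the same setting, if `s ↦ φ_s g` has derivative V at s, then `V ≠ 0` and Λ has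
derivative **`β₀∕V`** at `x = φ_s g` (`Λ⁻¹ y = φ_{(y − Λ g)∕β₀} g` expands chart distances by part 35's upper bound, so its derivative `V∕β₀` cannot vanish, and Λ is
the left inverse). [folklore] -/
theorem hasDerivAt_abel_of_hasDerivAt_rg (hanti : StrictAntiOn Λ (Ioc 0 e')) (honto : ∀ y : ℝ, Λ e' ≤ y → ∃ x ∈ Ioc (0 : ℝ) e', Λ x = y) (hβ₀ : 0 < β₀)
    (hbounds : ∀ e₁ ∈ Ioc (0 : ℝ) e', ∀ e₂ ∈ Ioc (0 : ℝ) e', e₁ ≤ e₂ →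
      2 / 3 * (1 / e₁ ^ 2 - 1 / e₂ ^ 2) ≤ Λ e₁ - Λ e₂ ∧ Λ e₁ - Λ e₂ ≤ 4 / 3 * (1 / e₁ ^ 2 - 1 / e₂ ^ 2))
    {g s V : ℝ} (hgs : Λ e' < Λ g + s * β₀) (hV : HasDerivAt (fun σ : ℝ => invFunOn Λ (Ioc 0 e') (Λ g + σ * β₀)) V s) :
    V ≠ 0 ∧ HasDerivAt Λ (β₀ / V) (invFunOn Λ (Ioc 0 e') (Λ g + s * β₀)) := by
  obtain ⟨hxmem, hΛx⟩ := rg_mem_eq_of_le honto hgs.le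
  set x := invFunOn Λ (Ioc 0 e') (Λ g + s * β₀) with hxdef
  have he' : e' ∈ Ioc (0 : ℝ) e' := ⟨hxmem.1.trans_le hxmem.2, le_rfl⟩
  have hxlt : x < e' := by
    rcases hxmem.2.lt_or_eq with h | h
    · exact h
    · exfalso; rw [h] at hΛx; linarith
  -- `Λ⁻¹ = (σ ↦ φ_σ g) ∘ (y ↦ (y − Λ g)∕β₀)` has derivative `V∕β₀` at `Λ x`
  have hinner : HasDerivAt (fun y : ℝ => (y - Λ g) / β₀) (1 / β₀) (Λ x) := by
    have := ((hasDerivAt_id (Λ x)).sub_const (Λ g)).div_const β₀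
    simpa using this
  have hσ : (Λ x - Λ g) / β₀ = s := by rw [hΛx]; field_simp; ring
  have hV' : HasDerivAt (fun σ : ℝ => invFunOn Λ (Ioc 0 e') (Λ g + σ * β₀)) V ((fun y : ℝ => (y - Λ g) / β₀) (Λ x)) := by
    simp only [hσ]; exact hV
  have hcomp := hV'.comp (Λ x) hinner
  have heq : ((fun σ : ℝ => invFunOn Λ (Ioc 0 e') (Λ g + σ * β₀)) ∘ fun y : ℝ => (y - Λ g) / β₀) = invFunOn Λ (Ioc 0 e') := by
    funext y
    simp only [Function.comp]
    rw [div_mul_cancel₀ _ hβ₀.ne', show Λ g + (y - Λ g) = y by ring]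
  rw [heq] at hcomp
  -- hcomp : HasDerivAt Λ⁻¹ (V * (1∕β₀)) (Λ x); it cannot vanish: Λ⁻¹ expands chart distances
  have hW : 3 * x ^ 4 / (32 * e') ≤ |V * (1 / β₀)| := by
    refine abs_deriv_ge_of_expansive hcomp ?_
    -- near `Λ x`, `y ≥ Λ e′` and `Λ⁻¹ y ≥ x∕2`
    have hcont : ContinuousAt (invFunOn Λ (Ioc 0 e')) (Λ x) :=
      abelInv_continuousAt hanti honto hβ₀ (fun e₁ h₁ e₂ h₂ h => (hbounds e₁ h₁ e₂ h₂ h).1) (by rw [hΛx]; exact hgs)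
    have hleft : invFunOn Λ (Ioc 0 e') (Λ x) = x := hanti.injOn.leftInvOn_invFunOn hxmem
    have hnear : ∀ᶠ y in 𝓝 (Λ x), x / 2 < invFunOn Λ (Ioc 0 e') y := by
      have : Ioi (x / 2) ∈ 𝓝 (invFunOn Λ (Ioc 0 e') (Λ x)) := by rw [hleft]; exact Ioi_mem_nhds (by linarith [hxmem.1])
      exact hcont this
    have hge : ∀ᶠ y in 𝓝 (Λ x), Λ e' ≤ y := by
      filter_upwards [Ici_mem_nhds (show Λ e' < Λ x by rw [hΛx]; exact hgs)] with y hy using hy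
    have hboth : ∀ᶠ y in 𝓝[≠] (Λ x), x / 2 < invFunOn Λ (Ioc 0 e') y ∧ Λ e' ≤ y := nhdsWithin_le_nhds (hnear.and hge)
    filter_upwards [hboth] with y hy
    obtain ⟨hz2, hy'⟩ := hy
    set z := invFunOn Λ (Ioc 0 e') y with hzdef
    have hzmem : z ∈ Ioc (0 : ℝ) e' := invFunOn_mem (honto y hy')
    have hΛz : Λ z = y := invFunOn_eq (honto y hy')
    -- `|y − Λ x| = |Λ z − Λ x| ≤ (4∕3)|1∕z² − 1∕x²| ≤ (32e′∕(3x⁴))·|z − x|`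
    have hx0 := hxmem.1
    have hz0 := hzmem.1
    have hchart : |Λ z - Λ x| ≤ 4 / 3 * |1 / z ^ 2 - 1 / x ^ 2| := by
      rcases le_total z x with hzx | hxz
      · obtain ⟨h1, h2⟩ := hbounds z hzmem x hxmem hzx
        have hnn : 0 ≤ 1 / z ^ 2 - 1 / x ^ 2 := by nlinarith
        rw [abs_of_nonneg (by linarith), abs_of_nonneg hnn]; exact h2
      · obtain ⟨h1, h2⟩ := hbounds x hxmem z hzmem hxz
        have hnn : 0 ≤ 1 / x ^ 2 - 1 / z ^ 2 := by nlinarith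
        rw [abs_sub_comm, abs_of_nonneg (by linarith), abs_sub_comm, abs_of_nonneg hnn]; exact h2
    have hfac : |1 / z ^ 2 - 1 / x ^ 2| = |z - x| * ((z + x) / (z ^ 2 * x ^ 2)) := by
      rw [show 1 / z ^ 2 - 1 / x ^ 2 = (x - z) * ((z + x) / (z ^ 2 * x ^ 2)) by field_simp; ring, abs_mul, abs_sub_comm,
        abs_of_pos (by positivity : 0 < (z + x) / (z ^ 2 * x ^ 2))]
    have hratio : (z + x) / (z ^ 2 * x ^ 2) ≤ 8 * e' / x ^ 4 := by
      rw [div_le_div_iff₀ (by positivity) (by positivity)]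
      have h1 : z + x ≤ 2 * e' := by linarith [hzmem.2, hxmem.2]
      have hz2' : x ^ 2 ≤ 4 * z ^ 2 := by nlinarith [mul_pos (by linarith : 0 < 2 * z - x) (by linarith : 0 < 2 * z + x)]
      have h2 : x ^ 4 ≤ 4 * (z ^ 2 * x ^ 2) :=
        calc x ^ 4 = x ^ 2 * x ^ 2 := by ring
          _ ≤ 4 * z ^ 2 * x ^ 2 := mul_le_mul_of_nonneg_right hz2' (sq_nonneg x)
          _ = 4 * (z ^ 2 * x ^ 2) := by ring
      calc (z + x) * x ^ 4 ≤ 2 * e' * (4 * (z ^ 2 * x ^ 2)) := mul_le_mul h1 h2 (by positivity) (by linarith [he'.1])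
        _ = 8 * e' * (z ^ 2 * x ^ 2) := by ring
    rw [hΛz] at hchart
    have he'0 := he'.1
    calc 3 * x ^ 4 / (32 * e') * |y - Λ x| = 3 * x ^ 4 / (32 * e') * |y - Λ x| := rfl
      _ ≤ 3 * x ^ 4 / (32 * e') * (4 / 3 * (|z - x| * (8 * e' / x ^ 4))) := by
          refine mul_le_mul_of_nonneg_left ?_ (by positivity)
          calc |y - Λ x| ≤ 4 / 3 * |1 / z ^ 2 - 1 / x ^ 2| := hchart
            _ = 4 / 3 * (|z - x| * ((z + x) / (z ^ 2 * x ^ 2))) := by rw [hfac]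
            _ ≤ 4 / 3 * (|z - x| * (8 * e' / x ^ 4)) := by
                refine mul_le_mul_of_nonneg_left (mul_le_mul_of_nonneg_left hratio (abs_nonneg _)) (by norm_num)
      _ = |z - x| := by field_simp; ring
      _ = |invFunOn Λ (Ioc 0 e') y - invFunOn Λ (Ioc 0 e') (Λ x)| := by rw [hleft]
  have hVne : V ≠ 0 := by
    intro hV0
    rw [hV0, zero_mul, abs_zero] at hW
    have : 0 < 3 * x ^ 4 / (32 * e') := by have := he'.1; have := hxmem.1; positivity
    linarith
  refine ⟨hVne, ?_⟩
  -- Λ is the left inverse of Λ⁻¹ near x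
  have hcontΛ : ContinuousAt Λ x := abel_continuousAt hbounds ⟨hxmem.1, hxlt⟩
  have hleft : invFunOn Λ (Ioc 0 e') (Λ x) = x := hanti.injOn.leftInvOn_invFunOn hxmem
  have hcomp' : HasDerivAt (invFunOn Λ (Ioc 0 e')) (V * (1 / β₀)) (Λ x) := hcomp
  have hfg : ∀ᶠ z in 𝓝 x, invFunOn Λ (Ioc 0 e') (Λ z) = z := by
    filter_upwards [mem_of_superset (Ioo_mem_nhds hxmem.1 hxlt) Ioo_subset_Ioc_self] with z hz
    exact hanti.injOn.leftInvOn_invFunOn hz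
  have hne : V * (1 / β₀) ≠ 0 := mul_ne_zero hVne (by positivity)
  have := hcomp'.of_local_left_inverse hcontΛ hne hfg
  refine this.congr_deriv ?_
  field_simp

/-- **THE SCALES WITH A VELOCITY ARE THE VISITS TO THE DIFFERENTIABILITY SET OF Λ**: `s ↦ φ_s g` is differentiable at s IFF Λ is differentiable at `φ_s g`
(interior running coupling). [folklore] -/
theorem differentiableAt_rg_iff (hanti : StrictAntiOn Λ (Ioc 0 e')) (honto : ∀ y : ℝ, Λ e' ≤ y → ∃ x ∈ Ioc (0 : ℝ) e', Λ x = y) (hβ₀ : 0 < β₀)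
    (hbounds : ∀ e₁ ∈ Ioc (0 : ℝ) e', ∀ e₂ ∈ Ioc (0 : ℝ) e', e₁ ≤ e₂ →
      2 / 3 * (1 / e₁ ^ 2 - 1 / e₂ ^ 2) ≤ Λ e₁ - Λ e₂ ∧ Λ e₁ - Λ e₂ ≤ 4 / 3 * (1 / e₁ ^ 2 - 1 / e₂ ^ 2))
    {g s : ℝ} (hgs : Λ e' < Λ g + s * β₀) :
    DifferentiableAt ℝ (fun σ : ℝ => invFunOn Λ (Ioc 0 e') (Λ g + σ * β₀)) s ↔ DifferentiableAt ℝ Λ (invFunOn Λ (Ioc 0 e') (Λ g + s * β₀)) := by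
  constructor
  · intro h
    exact (hasDerivAt_abel_of_hasDerivAt_rg hanti honto hβ₀ hbounds hgs h.hasDerivAt).2.differentiableAt
  · intro h
    exact (hasDerivAt_rg_of_hasDerivAt_abel hanti honto hβ₀ hbounds hgs h.hasDerivAt).differentiableAt

/-- **THE DEPENDENCE ON THE PIN**: `g` interior with `Λ e′ < Λ g + sβ₀`, Λ differentiable at g (derivative D_g) and at `x = φ_s g` (derivative D).  THEN
**`∂_g φ_s g = D_g∕D = Λ′(g)∕Λ′(φ_s g)`** — the classical `∂g(s)∕∂g(0) = β(g(s))∕β(g(0))`. [folklore] -/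
theorem hasDerivAt_rg_pin (hanti : StrictAntiOn Λ (Ioc 0 e')) (honto : ∀ y : ℝ, Λ e' ≤ y → ∃ x ∈ Ioc (0 : ℝ) e', Λ x = y) (hβ₀ : 0 < β₀)
    (hbounds : ∀ e₁ ∈ Ioc (0 : ℝ) e', ∀ e₂ ∈ Ioc (0 : ℝ) e', e₁ ≤ e₂ →
      2 / 3 * (1 / e₁ ^ 2 - 1 / e₂ ^ 2) ≤ Λ e₁ - Λ e₂ ∧ Λ e₁ - Λ e₂ ≤ 4 / 3 * (1 / e₁ ^ 2 - 1 / e₂ ^ 2))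
    {g s Dg D : ℝ} (hgs : Λ e' < Λ g + s * β₀) (hDg : HasDerivAt Λ Dg g) (hD : HasDerivAt Λ D (invFunOn Λ (Ioc 0 e') (Λ g + s * β₀))) :
    HasDerivAt (fun g' : ℝ => invFunOn Λ (Ioc 0 e') (Λ g' + s * β₀)) (Dg / D) g := by
  obtain ⟨hxmem, hΛx⟩ := rg_mem_eq_of_le honto hgs.le
  set x := invFunOn Λ (Ioc 0 e') (Λ g + s * β₀) with hxdef
  have hxlt : x < e' := by
    rcases hxmem.2.lt_or_eq with h | h
    · exact h
    · exfalso; rw [h] at hΛx; linarith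
  have hinv := hasDerivAt_abelInv hanti honto hβ₀ hbounds ⟨hxmem.1, hxlt⟩ hD
  rw [hΛx] at hinv
  have hinner : HasDerivAt (fun g' : ℝ => Λ g' + s * β₀) Dg g := by
    have := hDg.add_const (s * β₀)
    simpa using this
  have hcomp := hinv.comp g hinner
  refine (hcomp.congr_of_eventuallyEq (Eventually.of_forall fun σ => rfl)).congr_deriv ?_
  rw [div_eq_inv_mul]

/-- **THE LINEAR RENORMALIZATION-GROUP EQUATION** `∂_s φ = β_c(g)·∂_g φ`, `β_c := β₀∕Λ′`: in the setting of `hasDerivAt_rg_pin`, the scale derivative `β₀∕D` and the pin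
derivative `D_g∕D` of `φ_s g` satisfy **`β₀∕D = (β₀∕D_g)·(D_g∕D)`** — the running coupling is transported along the vector field β_c; equivalently Λ is a first
integral of `∂_s − β_c(g)∂_g`. [folklore] -/
theorem rg_transport (hanti : StrictAntiOn Λ (Ioc 0 e')) (honto : ∀ y : ℝ, Λ e' ≤ y → ∃ x ∈ Ioc (0 : ℝ) e', Λ x = y) (hβ₀ : 0 < β₀)
    (hbounds : ∀ e₁ ∈ Ioc (0 : ℝ) e', ∀ e₂ ∈ Ioc (0 : ℝ) e', e₁ ≤ e₂ →
      2 / 3 * (1 / e₁ ^ 2 - 1 / e₂ ^ 2) ≤ Λ e₁ - Λ e₂ ∧ Λ e₁ - Λ e₂ ≤ 4 / 3 * (1 / e₁ ^ 2 - 1 / e₂ ^ 2))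
    {g s Dg D : ℝ} (hg : g ∈ Ioo (0 : ℝ) e') (hgs : Λ e' < Λ g + s * β₀) (hDg : HasDerivAt Λ Dg g)
    (hD : HasDerivAt Λ D (invFunOn Λ (Ioc 0 e') (Λ g + s * β₀))) :
    HasDerivAt (fun σ : ℝ => invFunOn Λ (Ioc 0 e') (Λ g + σ * β₀)) (β₀ / D) s ∧
      HasDerivAt (fun g' : ℝ => invFunOn Λ (Ioc 0 e') (Λ g' + s * β₀)) (Dg / D) g ∧
      β₀ / D = β₀ / Dg * (Dg / D) := by
  have hDgne : Dg ≠ 0 := (hasDerivAt_abel_bounds hbounds hg hDg).2.2.ne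
  exact ⟨hasDerivAt_rg_of_hasDerivAt_abel hanti honto hβ₀ hbounds hgs hD, hasDerivAt_rg_pin hanti honto hβ₀ hbounds hgs hDg hD,
    by field_simp⟩

/-! ## §89 The size of the velocity where it exists -/

/-- **THE VELOCITY IS NEGATIVE AND OF ONE-LOOP SIZE**: if `s ↦ φ_s g` has derivative V at s (`x = φ_s g` interior), then **`−(3∕4)β₀x³ ≤ V ≤ −(3∕8)β₀x³`** — the
infinitesimal form of part 46's chart rates `(3∕4)β₀ … (3∕2)β₀` (part 56 sharpens the constants to `½(1 ± O(x))`). [folklore] -/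
theorem velocity_bounds (hanti : StrictAntiOn Λ (Ioc 0 e')) (honto : ∀ y : ℝ, Λ e' ≤ y → ∃ x ∈ Ioc (0 : ℝ) e', Λ x = y) (hβ₀ : 0 < β₀)
    (hbounds : ∀ e₁ ∈ Ioc (0 : ℝ) e', ∀ e₂ ∈ Ioc (0 : ℝ) e', e₁ ≤ e₂ →
      2 / 3 * (1 / e₁ ^ 2 - 1 / e₂ ^ 2) ≤ Λ e₁ - Λ e₂ ∧ Λ e₁ - Λ e₂ ≤ 4 / 3 * (1 / e₁ ^ 2 - 1 / e₂ ^ 2))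
    {g s V : ℝ} (hgs : Λ e' < Λ g + s * β₀) (hV : HasDerivAt (fun σ : ℝ => invFunOn Λ (Ioc 0 e') (Λ g + σ * β₀)) V s) :
    -(3 / 4) * β₀ * invFunOn Λ (Ioc 0 e') (Λ g + s * β₀) ^ 3 ≤ V ∧ V ≤ -(3 / 8) * β₀ * invFunOn Λ (Ioc 0 e') (Λ g + s * β₀) ^ 3 ∧ V < 0 := by
  obtain ⟨hxmem, hΛx⟩ := rg_mem_eq_of_le honto hgs.le
  set x := invFunOn Λ (Ioc 0 e') (Λ g + s * β₀) with hxdef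
  have hxlt : x < e' := by
    rcases hxmem.2.lt_or_eq with h | h
    · exact h
    · exfalso; rw [h] at hΛx; linarith
  obtain ⟨hVne, hD⟩ := hasDerivAt_abel_of_hasDerivAt_rg hanti honto hβ₀ hbounds hgs hV
  obtain ⟨h1, h2, h3⟩ := hasDerivAt_abel_bounds hbounds ⟨hxmem.1, hxlt⟩ hD
  have hx3 : 0 < x ^ 3 := pow_pos hxmem.1 3
  -- `D = β₀∕V ∈ [−8∕(3x³), −4∕(3x³)]`, `D < 0` ⟹ `V = β₀∕D ∈ [−(3∕4)β₀x³, −(3∕8)β₀x³]`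
  have hVneg : V < 0 := by
    by_contra hnn
    push Not at hnn
    have : 0 ≤ β₀ / V := div_nonneg hβ₀.le hnn
    linarith
  have hVeq : V = β₀ / (β₀ / V) := by field_simp
  refine ⟨?_, ?_, hVneg⟩
  · -- from `β₀∕V ≤ −4∕(3x³)`: `V ≥ β₀∕(−4∕(3x³)) = −(3∕4)β₀x³`
    have key : β₀ / V * (3 * x ^ 3) ≤ -4 := by
      have := h2; rwa [le_div_iff₀ (by positivity)] at this
    have : β₀ * (3 * x ^ 3) ≥ -4 * V := by
      have := mul_le_mul_of_nonpos_right key hVneg.le  -- careful with signs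
      nlinarith [mul_div_cancel₀ β₀ hVne]
    nlinarith
  · have key : -8 ≤ β₀ / V * (3 * x ^ 3) := by
      have := h1; rwa [div_le_iff₀ (by positivity)] at this
    have : -8 * V ≥ β₀ * (3 * x ^ 3) := by
      nlinarith [mul_div_cancel₀ β₀ hVne, mul_le_mul_of_nonpos_right key hVneg.le]
    nlinarith

/-- **THE VELOCITY IN THE CHART**: if `s ↦ φ_s g` has derivative V at s (`x = φ_s g` interior), then `s ↦ 1∕φ_s(g)²` has derivative `−2V∕x³` there, and
**`(3∕4)β₀ ≤ −2V∕x³ ≤ (3∕2)β₀`** — the continuous β-function in the chart `1∕g²` is β₀ up to the factor `[3∕4, 3∕2]` (part 56: `1 ± O(x)`). [folklore] -/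
theorem hasDerivAt_rg_chart (hanti : StrictAntiOn Λ (Ioc 0 e')) (honto : ∀ y : ℝ, Λ e' ≤ y → ∃ x ∈ Ioc (0 : ℝ) e', Λ x = y) (hβ₀ : 0 < β₀)
    (hbounds : ∀ e₁ ∈ Ioc (0 : ℝ) e', ∀ e₂ ∈ Ioc (0 : ℝ) e', e₁ ≤ e₂ →
      2 / 3 * (1 / e₁ ^ 2 - 1 / e₂ ^ 2) ≤ Λ e₁ - Λ e₂ ∧ Λ e₁ - Λ e₂ ≤ 4 / 3 * (1 / e₁ ^ 2 - 1 / e₂ ^ 2))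
    {g s V : ℝ} (hgs : Λ e' < Λ g + s * β₀) (hV : HasDerivAt (fun σ : ℝ => invFunOn Λ (Ioc 0 e') (Λ g + σ * β₀)) V s) :
    HasDerivAt (fun σ : ℝ => 1 / invFunOn Λ (Ioc 0 e') (Λ g + σ * β₀) ^ 2) (-2 * V / invFunOn Λ (Ioc 0 e') (Λ g + s * β₀) ^ 3) s ∧
      3 / 4 * β₀ ≤ -2 * V / invFunOn Λ (Ioc 0 e') (Λ g + s * β₀) ^ 3 ∧ -2 * V / invFunOn Λ (Ioc 0 e') (Λ g + s * β₀) ^ 3 ≤ 3 / 2 * β₀ := by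
  obtain ⟨hxmem, -⟩ := rg_mem_eq_of_le honto hgs.le
  set x := invFunOn Λ (Ioc 0 e') (Λ g + s * β₀) with hxdef
  obtain ⟨h1, h2, -⟩ := velocity_bounds hanti honto hβ₀ hbounds hgs hV
  have hx0 : 0 < x := hxmem.1
  have hx3 : 0 < x ^ 3 := pow_pos hx0 3
  refine ⟨?_, ?_, ?_⟩
  · have hp := (hV.pow 2).inv (pow_ne_zero 2 hx0.ne')
    have hp' : HasDerivAt (fun σ : ℝ => 1 / invFunOn Λ (Ioc 0 e') (Λ g + σ * β₀) ^ 2) (-(↑(2 : ℕ) * x ^ (2 - 1) * V) / (x ^ 2) ^ 2) s :=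
      hp.congr_of_eventuallyEq (Eventually.of_forall fun σ => by simp [one_div])
    refine hp'.congr_deriv ?_
    push_cast
    field_simp
  · rw [le_div_iff₀ hx3]; nlinarith
  · rw [div_le_iff₀ hx3]; nlinarith

/-- **AT ALMOST EVERY SCALE THE GELL-MANN–LOW EQUATION HOLDS**: for every `g ∈ ]0, e′]`, for Lebesgue-a.e. `s > 0` there is D (`= Λ′(φ_s g) < 0`) with Λ differentiable
at `φ_s g` with derivative D and `∂_s φ_s g = β₀∕D ∈ [−(3∕4)β₀ φ_s(g)³, −(3∕8)β₀ φ_s(g)³]`. [folklore] -/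
theorem ae_velocity (hanti : StrictAntiOn Λ (Ioc 0 e')) (honto : ∀ y : ℝ, Λ e' ≤ y → ∃ x ∈ Ioc (0 : ℝ) e', Λ x = y) (hβ₀ : 0 < β₀)
    (hbounds : ∀ e₁ ∈ Ioc (0 : ℝ) e', ∀ e₂ ∈ Ioc (0 : ℝ) e', e₁ ≤ e₂ →
      2 / 3 * (1 / e₁ ^ 2 - 1 / e₂ ^ 2) ≤ Λ e₁ - Λ e₂ ∧ Λ e₁ - Λ e₂ ≤ 4 / 3 * (1 / e₁ ^ 2 - 1 / e₂ ^ 2))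
    {g : ℝ} (hg : g ∈ Ioc (0 : ℝ) e') :
    ∀ᵐ s, s ∈ Ioi (0 : ℝ) → ∃ D : ℝ, HasDerivAt Λ D (invFunOn Λ (Ioc 0 e') (Λ g + s * β₀)) ∧ D < 0 ∧
      HasDerivAt (fun σ : ℝ => invFunOn Λ (Ioc 0 e') (Λ g + σ * β₀)) (β₀ / D) s ∧
      -(3 / 4) * β₀ * invFunOn Λ (Ioc 0 e') (Λ g + s * β₀) ^ 3 ≤ β₀ / D ∧
      β₀ / D ≤ -(3 / 8) * β₀ * invFunOn Λ (Ioc 0 e') (Λ g + s * β₀) ^ 3 := by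
  have he' : e' ∈ Ioc (0 : ℝ) e' := ⟨hg.1.trans_le hg.2, le_rfl⟩
  have hΛg : Λ e' ≤ Λ g := hanti.antitoneOn hg he' hg.2
  filter_upwards [ae_differentiableAt_rg hanti honto hβ₀ hg] with s hs hso
  have hgs : Λ e' < Λ g + s * β₀ := by have := mul_pos (mem_Ioi.1 hso) hβ₀; linarith
  have hV := (hs hso).hasDerivAt
  obtain ⟨hVne, hD⟩ := hasDerivAt_abel_of_hasDerivAt_rg hanti honto hβ₀ hbounds hgs hV
  set V := deriv (fun σ : ℝ => invFunOn Λ (Ioc 0 e') (Λ g + σ * β₀)) s with hVdef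
  obtain ⟨h1, h2, -⟩ := velocity_bounds hanti honto hβ₀ hbounds hgs hV
  have hDneg : β₀ / V < 0 := by
    obtain ⟨hxmem, hΛx⟩ := rg_mem_eq_of_le honto hgs.le
    have hxlt : invFunOn Λ (Ioc 0 e') (Λ g + s * β₀) < e' := by
      rcases hxmem.2.lt_or_eq with h | h
      · exact h
      · exfalso; rw [h] at hΛx; linarith
    exact (hasDerivAt_abel_bounds hbounds ⟨hxmem.1, hxlt⟩ hD).2.2
  refine ⟨β₀ / V, hD, hDneg, ?_, ?_, ?_⟩
  · have : β₀ / (β₀ / V) = V := by field_simp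
    rw [this]; exact hV
  · have : β₀ / (β₀ / V) = V := by field_simp
    rw [this]; exact h1
  · have : β₀ / (β₀ / V) = V := by field_simp
    rw [this]; exact h2

end

end Summit.QuantumFields.BalabanUV.Beta.EriceFlowEnclosureB12AsPrintedHistoryContagionShiftFlowZeroSemigroupGellMannLow
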